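import Summits.ResolutionOfSingularities.ResolutionOfSingularities.Theorems.FrobeniusClosingPatchingRelPerfectMonomialRouteKStepReadings
import HarnessLib

/-!
# Crux `PatchingRelPerfect` (stmt-ResolutionOfSingularities-16161), chain w52 — TargetsF3 (m)
# «M2-strong», COMBINATORIAL HALF, Route K step K13c: (G2) at the next level — the new charts read the
# controlled transform as the monomial ideal of the MOVED exponent vectors; cones and covers

[OURS · L1 W5.2 · design memo v3 (`L/res-type-075/M2STRONG-COMBINATORIAL-HALF.md`); fact-free;
nothing here is a statement of the manuscript under review]

* **`Good.img_newM`** — in every new chart the ideal of Kollár's transformed marked ideal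
  (`M.transform π C`, controlled transform with marking `m`) is the monomial ideal of the exponent
  vectors of the state after the block play (`State.moves`, `blockExp`, file K10): the scheme-side
  controlled transform IS the game's `c = m` bookkeeping (files K12a/K12b for the chart computation).
* `Good.newCharts_cone_mem`, `Good.newCharts_cov_str`, `Good.newCharts_cov_pts` — the cones of the new
  charts are strata of the moved state, every stratum of the moved state lies in a new cone
  (file K10 `mem_moves_Str_iff`), and the new charts cover `Bl_C Y` (file K11).
-/

-- `Summit.<Summit>.<Sub>.Theorems` with `Sub = Summit` (single-conjunct summit, D-0017)
set_option linter.dupNamespace false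

noncomputable section

open CategoryTheory AlgebraicGeometry TopologicalSpace MvPolynomial
open Literature.AlgebraicGeometry.Resolution

namespace Summit.ResolutionOfSingularities.ResolutionOfSingularities.Theorems

namespace PolyhedraGame

namespace RouteK

variable {L : Finset ℕ} {m : ℕ} {s : State} {Y : Scheme.{0}} {D : ℕ → Y.IdealSheafData} {M : MarkedIdeal Y}
  {C : Y.IdealSheafData} {rest : CentreSeq (blowup C)} {𝒞 : Set (Chart L Y)}
  (G : Good L m s Y D M (CentreSeq.cons C rest) 𝒞) (hm : 1 ≤ m) (hs : s.WF)
include G hm hs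

/-- [OURS] The components form a disjoint family of permissible strata. -/
theorem Good.disjointFamily_components : DisjointFamily m s G.components := by
  exact ⟨fun J hJ => G.permissibleM_of_mem_components hJ, fun J hJ J' hJ' hne => G.union_not_mem_of_ne hm hs hJ hJ' hne⟩


variable {mv : List (Finset ℕ × ℕ)} (hmv : BlockPlay m s G.components mv)
include hmv

/-! ## The exponent vectors after the block, read in the new charts -/

/-- [OURS] The names of the block are not members of any centre of the block. -/
theorem Good.name_not_mem_centre (p : Finset ℕ × ℕ) (hp : p ∈ mv) (q : Finset ℕ × ℕ) (hq : q ∈ mv) :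
    p.2 ∉ q.1 := fun h =>
  G.name_not_mem_B hm hs hmv hp (hs.str_subset _ (G.mem_components_iff.mp ((BlockPlay.fresh hmv).1 q hq).1).1 h)

/-- [OURS] The exponent vectors of the state vanish at the names of the block. -/
theorem Good.apply_name_eq_zero {α : ℕ →₀ ℕ} (hα : α ∈ s.A) (p : Finset ℕ × ℕ) (hp : p ∈ mv) : α p.2 = 0 :=
  Finsupp.notMem_support_iff.mp fun h => G.name_not_mem_B hm hs hmv hp (hs.support_subset α hα h)

/-- [OURS] **The moved exponent vector read in a chart of the family**: at the blown-up variable `j` it is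
`|α_S| - m`, elsewhere it is the old chart exponent. -/
theorem Good.expOf_famChart_blockExp {c : Chart L Y} (hc : c ∈ 𝒞) {S : Finset L}
    (hS : c.img C = coordIdeal S) (j : S) {e : ℕ} (hJe : (c.labels S, e) ∈ mv) {α : ℕ →₀ ℕ} (hα : α ∈ s.A) :
    (famChart c S hS j e).expOf (blockExp m mv α) =
      c.expOf α + Finsupp.single (j : L) (sdeg (S.erase j) (c.expOf α)) - Finsupp.single (j : L) m := by
  ext b
  rw [Chart.expOf_apply, Finsupp.tsub_apply, Finsupp.add_apply]
  by_cases hbj : b = (j : L)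
  · subst hbj
    rw [famChart_lab_self, Finsupp.single_eq_same, Finsupp.single_eq_same,
      blockExp_apply_name m mv α (BlockPlay.fresh hmv).2 (G.name_not_mem_centre hm hs hmv)
        (G.apply_name_eq_zero hm hs hmv hα) _ hJe]
    change weight (c.labels S) α - m = _
    rw [c.weight_labels (G.lab_inj c hc), Chart.expOf_apply, sdeg, sdeg, ← Finset.add_sum_erase S _ j.2]
    rfl
  · rw [famChart_lab_of_ne c S hS j e hbj, Finsupp.single_eq_of_ne hbj, Finsupp.single_eq_of_ne hbj,
      add_zero, Nat.sub_zero, blockExp_apply_of_forall_ne m mv α fun p hp h =>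
        G.name_not_mem_B hm hs hmv hp (h ▸ G.lab_mem_B hm hs hmv hc b)]
    rfl

/-- [OURS] The moved exponent vector read in a lifted chart is the old chart exponent. -/
theorem Good.expOf_liftChart_blockExp {c : Chart L Y} (hc : c ∈ 𝒞) (htop : c.img C = ⊤) {α : ℕ →₀ ℕ}
    (hα : α ∈ s.A) : (liftChart c htop).expOf (blockExp m mv α) = c.expOf α := by
  have _ := hα
  ext b
  rw [Chart.expOf_apply, Chart.expOf_apply]
  change blockExp m mv α (c.lab b) = α (c.lab b)
  exact blockExp_apply_of_forall_ne m mv α fun p hp h => G.name_not_mem_B hm hs hmv hp (h ▸ G.lab_mem_B hm hs hmv hc b)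

/-! ## (G2) at the next level -/

/-- [OURS · Route K] **(G2) at the next level**: every new chart reads Kollár's transformed marked ideal
as the monomial ideal of the moved exponent vectors. -/
theorem Good.img_newM {c' : Chart L (blowup C)} (hc' : c' ∈ newCharts 𝒞 C mv) :
    c'.img (M.transform (blowup.π C) C).ideal = c'.monIdeal (s.moves m mv).A := by
  haveI := G.locNoeth
  haveI : IsLocallyNoetherian (blowup C) := CentreSeq.isLocallyNoetherian_blowup C
  rw [MarkedIdeal.transform_ideal, G.mult, moves_A]
  rcases hc' with ⟨c, hc, S, hS, j, e, hJe, rfl⟩ | ⟨c, hc, htop, rfl⟩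
  · haveI := (famMap_spec c S hS).1 j
    have hg := (famMap_spec c S hS).2.1 j
    -- permissibility of the seen component: every member has `S`-degree `≥ m`
    have hA : ∀ α ∈ s.A, m ≤ sdeg S (c.expOf α) := by
      intro α hα
      have hperm := G.permissibleM_of_mem_components (G.mem_components_of_sees hs hc ⟨S, ?_, hS, rfl⟩)
      · rw [← c.weight_labels (G.lab_inj c hc)]
        exact hperm.2.2 α hα
      · rcases G.exists_sees_or_top hm hs hc with htop | ⟨J, S', hS'ne, hS', -⟩
        · rw [hS] at htop; exact absurd htop (coordIdeal_isPrime S).ne_top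
        · rwa [G.coordIdeal_injective (hS.symm.trans hS')]
    rw [famChart, img_new_controlled c hS j.2 _ (famMap c S hS j) hg (G.img_M c hc) m hA, Chart.monIdeal,
      Finset.coe_image, ← Set.image_comp]
    apply congrArg Ideal.span
    refine Set.image_congr fun α hα => ?_
    rw [Function.comp_apply, ← famChart, G.expOf_famChart_blockExp hm hs hmv hc hS j hJe (Finset.mem_coe.mp hα)]
  · haveI := (liftMap_spec c htop).1
    have hg := (liftMap_spec c htop).2.1
    rw [liftChart, img_lift_controlled c htop c.lab (liftMap c htop) hg, G.img_M c hc, Chart.monIdeal, Chart.monIdeal,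
      Finset.coe_image, ← Set.image_comp]
    apply congrArg Ideal.span
    refine Set.image_congr fun α hα => ?_
    rw [Function.comp_apply, ← liftChart, G.expOf_liftChart_blockExp hm hs hmv hc htop (Finset.mem_coe.mp hα)]

/-! ## Cones of the new charts are strata of the moved state -/

/-- [OURS · Route K] **The cones of the new charts are strata of the moved state.** -/
theorem Good.newCharts_cone_mem {c' : Chart L (blowup C)} (hc' : c' ∈ newCharts 𝒞 C mv) :
    c'.cone ∈ (s.moves m mv).Str := by
  rw [mem_moves_Str_iff mv hs (G.disjointFamily_components hm hs) hmv]
  rcases hc' with ⟨c, hc, S, hS, j, e, hJe, rfl⟩ | ⟨c, hc, htop, rfl⟩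
  · right
    refine ⟨(c.labels S, e), hJe, c.cone.erase (c.lab (j : L)), ?_, ?_, ?_, ?_⟩
    · exact hs.str_down _ (G.cone_mem c hc) _ (Finset.erase_subset _ _)
    · intro h
      have := h (Finset.mem_image_of_mem (fun b : L => c.lab b) j.2)
      exact Finset.notMem_erase _ _ this
    · have : c.cone.erase (c.lab (j : L)) ∪ c.labels S = c.cone := by
        apply Finset.Subset.antisymm
        · exact Finset.union_subset (Finset.erase_subset _ _) (c.labels_subset_cone S)
        · intro l hl
          by_cases hlj : l = c.lab (j : L)
          · exact Finset.mem_union_right _ (hlj ▸ Finset.mem_image_of_mem (fun b : L => c.lab b) j.2)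
          · exact Finset.mem_union_left _ (Finset.mem_erase.mpr ⟨hlj, hl⟩)
      rw [this]; exact G.cone_mem c hc
    · exact cone_famChart c (G.lab_inj c hc) S hS j e
  · left
    exact ⟨G.cone_mem c hc, fun p hp => G.not_subset_cone_of_img_eq_top hm hs hmv hc htop hp⟩

/-- [OURS · Route K] **Every stratum of the moved state lies in the cone of a new chart.** -/
theorem Good.newCharts_cov_str {T : Finset ℕ} (hT : T ∈ (s.moves m mv).Str) :
    ∃ c' ∈ newCharts 𝒞 C mv, T ⊆ c'.cone := by
  rw [mem_moves_Str_iff mv hs (G.disjointFamily_components hm hs) hmv] at hT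
  rcases hT with ⟨hT, hnot⟩ | ⟨⟨J, e⟩, hJe, T₀, hT₀, hJT₀, hT₀J, rfl⟩
  · obtain ⟨c, hc, hTc⟩ := G.cov_str T hT
    rcases G.exists_sees_or_top hm hs hc with htop | ⟨J, S, hSne, hS, rfl⟩
    · exact ⟨liftChart c htop, Or.inr ⟨c, hc, htop, rfl⟩, hTc⟩
    · obtain ⟨e, hJe⟩ := G.exists_name_of_img_eq hm hs hmv hc hS
      -- some variable of `S` is not labelled in `T`
      have hJT : ¬ c.labels S ⊆ T := hnot _ hJe
      obtain ⟨l, hlJ, hlT⟩ := Finset.not_subset.mp hJT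
      obtain ⟨b, hb, rfl⟩ := Finset.mem_image.mp hlJ
      refine ⟨famChart c S hS ⟨b, hb⟩ e, Or.inl ⟨c, hc, S, hS, ⟨b, hb⟩, e, hJe, rfl⟩, ?_⟩
      rw [cone_famChart c (G.lab_inj c hc) S hS ⟨b, hb⟩ e]
      intro l hl
      exact Finset.mem_insert_of_mem (Finset.mem_erase.mpr ⟨fun h => hlT (h ▸ hl), hTc hl⟩)
  · obtain ⟨c, hc, hTc⟩ := G.cov_str _ hT₀J
    -- `c` contains the component `J`, hence sees it
    have hJc : J ⊆ c.cone := fun l hl => hTc (Finset.mem_union_right _ hl)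
    obtain ⟨-, c₁, hc₁, hsees⟩ := G.mem_components_iff.mp ((BlockPlay.fresh hmv).1 (J, e) hJe).1
    obtain ⟨S, -, hS, hJS⟩ := Good.Sees.of_subset_cone G hm hs hc hc₁ hsees hJc
    simp only at hJS
    subst hJS
    obtain ⟨l, hlJ, hlT₀⟩ := Finset.not_subset.mp hJT₀
    obtain ⟨b, hb, rfl⟩ := Finset.mem_image.mp hlJ
    refine ⟨famChart c S hS ⟨b, hb⟩ e, Or.inl ⟨c, hc, S, hS, ⟨b, hb⟩, e, hJe, rfl⟩, ?_⟩
    rw [cone_famChart c (G.lab_inj c hc) S hS ⟨b, hb⟩ e]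
    refine Finset.insert_subset_insert _ fun l hl => Finset.mem_erase.mpr ⟨fun h => hlT₀ (h ▸ hl), ?_⟩
    exact hTc (Finset.mem_union_left _ hl)

/-- [OURS · Route K] **The new charts cover `Bl_C Y`.** -/
theorem Good.newCharts_cov_pts (y' : blowup C) : ∃ c' ∈ newCharts 𝒞 C mv, y' ∈ (c'.U : (blowup C).Opens) := by
  obtain ⟨c, hc, hy⟩ := G.cov_pts (blowup.π C y')
  rcases G.exists_sees_or_top hm hs hc with htop | ⟨J, S, hSne, hS, rfl⟩
  · haveI := (liftMap_spec c htop).1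
    refine ⟨liftChart c htop, Or.inr ⟨c, hc, htop, rfl⟩, ?_⟩
    rw [liftChart, Chart.mem_ofMap_U_iff]
    exact (liftMap_spec c htop).2.2 y' hy
  · obtain ⟨e, hJe⟩ := G.exists_name_of_img_eq hm hs hmv hc hS
    obtain ⟨j, hj⟩ := (famMap_spec c S hS).2.2.1 y' hy
    haveI := (famMap_spec c S hS).1 j
    refine ⟨famChart c S hS j e, Or.inl ⟨c, hc, S, hS, j, e, hJe, rfl⟩, ?_⟩
    rw [famChart, Chart.mem_ofMap_U_iff]
    exact hj

end RouteK

end PolyhedraGame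

end Summit.ResolutionOfSingularities.ResolutionOfSingularities.Theorems

end
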